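/-
Copyright: lit-balaban reader/typer seat r18 (gen 9), cross-paper DEFINITIONS steward / C2 §§1–4 fold owner.  Statement-level skeleton
of a published paper; no proof claims beyond what the kernel checks below.
-/
import Literature.MathematicalPhysics.QuantumFieldTheory.BalabanImbrieJaffe1984to88.BIJ88Decay216Native
import Literature.MathematicalPhysics.QuantumFieldTheory.BalabanImbrieJaffe1984to88.BIJ88Eq220Torus

/-!
# `BalabanImbrieJaffe1984to88.BIJ85Prop522Rescaling` — T. Bałaban, J. Imbrie, A. Jaffe, *Renormalization of the Higgs model:
minimizers, propagators and the stability of mean field theory*, Commun. Math. Phys. **97** (1985) 299–329 [BalabanImbrieJaffe1985]: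
**THE RESCALING DICTIONARY, PART 2** — how the torus operators of record of Sects. 4–5 (`BIJ85Prop522Torus`: the Landau minimizer
`H_k` (4.4.2) `HkE`, the fluctuation covariance `𝒟_k` (4.4.4) `DkE`, the axial propagator `G_{k,Ax}` (5.2.2) `GaxE`; p09's
functional-integral propagator (4.1.1) `torusPropagator`; and the [BalabanImbrieJaffe1988] (2.21)/(2.22) gauge-function operators
`D_j = λ_j ∘ H_j` `BIJ88Eq220Torus.DjE`, `C_k` `BIJ88Eq220Torus.CkE` with p08/p30's `λ_j` (I.5.1.13) `lamOf`/`lamE`) depend on the two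
bookkeeping parameters of the cell's encoding, the pairing
weight `w` (`= η^d` in print) and the lattice factor `c` (`= η⁻¹`) of `∂ = √w·∂^{c}`.

statement-level skeleton of published theorems with citation tags; proofs where landed; nothing here is a claim about the Yang–Mills mass gap

PDF held: `paper:balaban1985-cmp97-bij-higgs-minimizers` (journal page = PDF page + 298), p. 312 [PDF 14] (4.4.2)–(4.4.4), p. 316 [PDF 18]
(5.2.2); and [BalabanImbrieJaffe1988] `paper:balaban1988-cmp114-bij-abelian-higgs-effective-action`, p. 261 [PDF 5] (2.12) (text layer
re-read this session: *"Superscripts L^jη, η, etc. indicate the lattice spacing for operators rescaled to nonstandard lattices"*).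

CITATION HEADER (lean-in-tree rule).  Part of the lit-balaban TYPED SKELETON (HOME `run/shared/lean/pub/lit-balaban/`), unit
`lit-balaban-r18` (READER/TYPER r18: cross-paper DEFINITIONS — averaging operators, minimizers, block fields; fold owner of C2 Sects. 1–4),
gen 9.  WHAT IS REPRODUCED: no SKELETON row changes head; this is the second half of the cell's RESCALING DICTIONARY for the [BIJ85]
operator vocabulary (part 1 = r18 gen 8 `BIJ88Decay216Native` §1: `axialPropagator_smul`, `haxOp_smul`, `haxE_eq_haxE_one`,
`cE_eq_smul_cE_one`, `cE_ambient_eq_native`; companions: p30's `BIJ85SigmaTorusScaling.sigmaTorus_eq_smul` for `σ_k`, p16's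
`B5Eq147TorusBridge.Hk_opsV1_indep` for the configuration-level `H_k`), recorded in `HOME/lit-balaban-r18/SKELETON-r18.md` Addendum 15
(rows A14 / X05 / C2.Eq2.12 / C2.Eq2.22 consumers).  WHY: the owner note O-C2-16 (GAPS.md G-C2-16) showed that consumers of the typed
[I]-inputs must say at WHICH `(w, c)` an operator is instantiated; these identities let a consumer move between the normalisation of
step `k` (`w = η_k^d`, `c = η_k⁻¹ = L^k`) and the unit normalisation `(1, 1)` by a displayed scalar.

WHAT IS PROVED (0 `sorry`, standard axioms; theorems only — proof lane):
* `hkE_eq_hkE_one`: **`HkE P w c j = HkE P 1 1 j`** (`j ≤ m + K`, `w > 0`, `c ≠ 0`) — the Landau minimizer OPERATOR does not depend on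
  the weights (both sides of the variational problem (4.4.3) scale; p16's `Hk_opsV1_indep` lifted to p11's operator `HkE`);
  `adjoint_hkE_eq_adjoint_hkE_one`.
* `dkE_eq_smul_dkE_one`: **`DkE P w c k = (w·c²)⁻¹ • DkE P 1 1 k`** (`k ≤ m + K + 1`) — `𝒟_k = Σ_{j<k} H_jC^{(j)}H_j*` is homogeneous of
  degree `−1` in `w·c²` (from `cE_eq_smul_cE_one`); at the normalisation of step `k`: `dkE_eta_eq` (`DkE P η_k^d L^k k = (L^k)^{d−2} •
  DkE P 1 1 k`, `d ≥ 2`), entries `inner_dkE_eta_eq`.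
* `gaxE_eq_smul_gaxE_one`: **`GaxE P w c k = (w·c²)⁻¹ • GaxE P 1 1 k`** (every `k`; no range hypothesis) and `gaxE_eta_eq`.
* `torusPropagator_eq_smul`: **`torusPropagator w c k = (c²)⁻¹ • torusPropagator 1 1 k`** (`w > 0`, `c ≠ 0`, every `k`) — p09's (4.1.1)
  propagator `G_{k,Ax}` (pairing weight absorbed: *"⟨A, J⟩ = Σ_b η^dA_bJ_b"*) is INDEPENDENT of `w` (`torusPropagator_indep_w`) and
  homogeneous of degree `−2` in `c`; `torusPropagator_eta_eq` (`= η_k² • torusPropagator 1 1 k` at `c = L^k`).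
* §4 the gauge functions: `lamOf_eq_smul` / `lamE_eq_smul` (**`λ_k` of (I.5.1.13) is homogeneous of degree `−1` in `c`**: the printed
  weights `L^{j−k} = L^j/c`), `djE_eq_smul` (**`DjE P w c j = c⁻¹ • DjE P 1 1 j`**, `j ≤ m + K`), `dOne_eq_smul` (p30's unit-lattice curl
  `dOne P k c = c • dOne P k 1`), and **`ckE_eq_smul`: `CkE P hd w c k = c⁻¹ • CkE P hd 1 1 k`** (`k ≤ m + K`, `w > 0`, `c ≠ 0`) — the
  (2.22) kernel `C_k = D_k + Σ_{j<k} D_jC^{(j)}H_j*∂*Q^{e*}_k∂` is WEIGHT-FREE and of degree `−1` in the lattice factor (the factors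
  `c⁻¹·(wc²)⁻¹·1·(√w·c)·√w·c` of its six constituents multiply to `c⁻¹`): a gauge function per unit `T^{(k)}`-field, like `λ`.
HONEST SCOPE.  Bookkeeping identities of the formalisation's encoding, each a one-line consequence of the print's homogeneity (the
(4.4.3)/(4.1.1) Gaussian weights are quadratic forms in `∂A`); they assert nothing about the paper beyond the displayed definitions.
No `def`, no new named fact, nothing restated; NOT summit progress.  Unit `lit-balaban-r18` (literature-prover-lit-balaban-r18-g9-0),
2026-08-21.
-/

open scoped BigOperators RealInnerProductSpace

namespace Literature.MathematicalPhysics.QuantumFieldTheory.BalabanImbrieJaffe1984to88.BIJ85Prop522Rescaling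

open Balaban1983to89 hiding Site Plaq
open Balaban1983to89.LatticeFieldCalculus
open Balaban1983to89.B5Eq147TorusBridge (Hk_opsV1_indep)
open BIJ85AxialPropagator411 BIJ85Prop521Torus BIJ85Prop522Torus BIJ85Sigma422Eta
open BIJ85SigmaTorusScaling (curlOp_eq_smul)
open BIJ88Decay216Native (axialPropagator_smul haxE_eq_haxE_one cE_eq_smul_cE_one)
open BIJ85SigmaTorusScaling (QesOp_eq_smul)
open BIJ85GaugeFunction5113 (lamOf lamOf_succ)
open BIJ85Prop511Torus (lamE lamE_apply)
open BIJ85Eq611Torus (dOne dOne_apply)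
open BIJ88Eq220Torus (DjE CkE)

noncomputable section

variable {P : Params}

/-- `0 < L^k` in `ℝ`. [folklore] -/
private theorem cast_pow_L_pos' (k : ℕ) : (0 : ℝ) < (P.L : ℝ) ^ k := pow_pos P.cast_L_pos k

/-- `η_k = (L^k)⁻¹`. [folklore] -/
private theorem eta_eq_inv (k : ℕ) : P.eta k = ((P.L : ℝ) ^ k)⁻¹ := by rw [Params.eta, inv_pow]

/-- `(η_k^d · (L^k)²)⁻¹ = (L^k)^{d−2}` for `d ≥ 2`. [folklore] -/
private theorem inv_eta_pow_mul_sq (hd : 2 ≤ P.d) (k : ℕ) :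
    ((P.eta k) ^ P.d * ((P.L : ℝ) ^ k) ^ 2)⁻¹ = ((P.L : ℝ) ^ k) ^ (P.d - 2) := by
  have hL : (P.L : ℝ) ^ k ≠ 0 := (cast_pow_L_pos' k).ne'
  rw [eta_eq_inv, inv_pow, mul_inv, inv_inv, ← pow_sub₀ _ hL hd]

/-! ## §1  The Landau minimizer operator `H_k` (4.4.2) does not depend on the weights -/

/-- **`H_k` AS AN OPERATOR IS WEIGHT-FREE**: `HkE P w c j = HkE P 1 1 j` for `j ≤ m + K`, `w > 0`, `c ≠ 0` — the constrained minimizer of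
`½‖√w·∂^{c}A‖² + ½‖R√w·∂^{c*}A‖²` on `{Q_jA = B}` is that of `(w, c) = (1, 1)`: both terms of (4.4.3) scale by `w·c²` and the fibre and
the gauge subspace `ΔN(Q′)` do not move (p16's `B5Eq147TorusBridge.Hk_opsV1_indep` at the configuration level, p11's `HkE_apply`).
[cite: BalabanImbrieJaffe1985, (4.4.2) p.312] -/
theorem hkE_eq_hkE_one {j : ℕ} (hj : j ≤ P.m + P.K) {w c : ℝ} (hw : 0 < w) (hc : c ≠ 0) : HkE P w c j = HkE P 1 1 j := by
  apply LinearMap.ext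
  intro B
  rw [HkE_apply hj hc hw, HkE_apply hj one_ne_zero one_pos, Real.sqrt_one,
    Hk_opsV1_indep hj hc (Real.sqrt_pos.2 hw).ne' one_ne_zero one_ne_zero]

/-- `H_k*` is weight-free as well. [cite: BalabanImbrieJaffe1985, (4.4.4) p.312] -/
theorem adjoint_hkE_eq_adjoint_hkE_one {j : ℕ} (hj : j ≤ P.m + P.K) {w c : ℝ} (hw : 0 < w) (hc : c ≠ 0) :
    LinearMap.adjoint (HkE P w c j) = LinearMap.adjoint (HkE P 1 1 j) := by
  rw [hkE_eq_hkE_one hj hw hc]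

/-! ## §2  The fluctuation covariance `𝒟_k` (4.4.4) is homogeneous of degree `−1` in `w·c²` -/

/-- **`𝒟_k = Σ_{j<k} H_jC^{(j)}H_j*` IS HOMOGENEOUS OF DEGREE `−1` IN `w·c²`**: `DkE P w c k = (w·c²)⁻¹ • DkE P 1 1 k` for `k ≤ m + K + 1`
(every summand `j < k` is in the standing range), `w > 0`, `c ≠ 0` — `H_j` is weight-free (§1) and `C^{(j)}` carries the factor
(`BIJ88Decay216Native.cE_eq_smul_cE_one`). [cite: BalabanImbrieJaffe1985, (4.4.4) p.312] -/
theorem dkE_eq_smul_dkE_one {k : ℕ} (hk : k ≤ P.m + P.K + 1) {w c : ℝ} (hw : 0 < w) (hc : c ≠ 0) :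
    DkE P w c k = (w * c ^ 2)⁻¹ • DkE P 1 1 k := by
  unfold DkE
  rw [Finset.smul_sum]
  refine Finset.sum_congr rfl fun j hj => ?_
  have hj' : j ≤ P.m + P.K := by have := Finset.mem_range.1 hj; omega
  rw [hkE_eq_hkE_one hj' hw hc, cE_eq_smul_cE_one hw hc j, LinearMap.smul_comp, LinearMap.comp_smul]

/-- at the normalisation of step `k` (`w = η_k^d = L^{−kd}`, `c = η_k⁻¹ = L^k`): `DkE P η_k^d L^k k = (L^k)^{d−2} • DkE P 1 1 k` (`d ≥ 2`,
`k ≤ m + K + 1`) — the scaling factor of an η-lattice bond-field covariance of dimension (length)^{2−d}.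
[cite: BalabanImbrieJaffe1988, (2.12) p.261] -/
theorem dkE_eta_eq (hd : 2 ≤ P.d) {k : ℕ} (hk : k ≤ P.m + P.K + 1) :
    DkE P ((P.eta k) ^ P.d) ((P.L : ℝ) ^ k) k = (((P.L : ℝ) ^ k) ^ (P.d - 2)) • DkE P 1 1 k := by
  rw [dkE_eq_smul_dkE_one hk (pow_pos (eta_pos P k) _) (cast_pow_L_pos' k).ne', inv_eta_pow_mul_sq hd]

/-- matrix entries of `𝒟_k` at the normalisation of step `k` versus the unit normalisation:
`⟨u, 𝒟_k^{(η_k^d, L^k)}v⟩ = (L^k)^{d−2}·⟨u, 𝒟_k^{(1,1)}v⟩`. [cite: BalabanImbrieJaffe1988, (2.12) p.261] -/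
theorem inner_dkE_eta_eq (hd : 2 ≤ P.d) {k : ℕ} (hk : k ≤ P.m + P.K + 1) (u v : BondSpace P) :
    ⟪u, DkE P ((P.eta k) ^ P.d) ((P.L : ℝ) ^ k) k v⟫ = ((P.L : ℝ) ^ k) ^ (P.d - 2) * ⟪u, DkE P 1 1 k v⟫ := by
  rw [dkE_eta_eq hd hk, LinearMap.smul_apply, real_inner_smul_right]

/-! ## §3  The axial propagator `G_{k,Ax}` (5.2.2) and p09's (4.1.1) propagator -/

/-- **`G_{k,Ax} = Σ_{j<k} H_{j,Ax}C^{(j)}H*_{j,Ax}` IS HOMOGENEOUS OF DEGREE `−1` IN `w·c²`**: `GaxE P w c k = (w·c²)⁻¹ • GaxE P 1 1 k`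
(`w > 0`, `c ≠ 0`, every `k`) — `H_{j,Ax}` is weight-free (`haxE_eq_haxE_one`) and `C^{(j)}` carries the factor.
[cite: BalabanImbrieJaffe1985, (5.2.2) p.316] -/
theorem gaxE_eq_smul_gaxE_one {w c : ℝ} (hw : 0 < w) (hc : c ≠ 0) (k : ℕ) :
    GaxE P w c k = (w * c ^ 2)⁻¹ • GaxE P 1 1 k := by
  unfold GaxE
  rw [Finset.smul_sum]
  refine Finset.sum_congr rfl fun j _ => ?_
  rw [haxE_eq_haxE_one hw hc j, cE_eq_smul_cE_one hw hc j, LinearMap.smul_comp, LinearMap.comp_smul]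

/-- at the normalisation of step `k`: `GaxE P η_k^d L^k k = (L^k)^{d−2} • GaxE P 1 1 k` (`d ≥ 2`). [cite: BalabanImbrieJaffe1985, (5.2.2) p.316] -/
theorem gaxE_eta_eq (hd : 2 ≤ P.d) (k : ℕ) :
    GaxE P ((P.eta k) ^ P.d) ((P.L : ℝ) ^ k) k = (((P.L : ℝ) ^ k) ^ (P.d - 2)) • GaxE P 1 1 k := by
  rw [gaxE_eq_smul_gaxE_one (pow_pos (eta_pos P k) _) (cast_pow_L_pos' k).ne', inv_eta_pow_mul_sq hd]

/-- **p09's (4.1.1) PROPAGATOR `G_{k,Ax}` (pairing weight absorbed) IS HOMOGENEOUS OF DEGREE `−2` IN THE LATTICE FACTOR AND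
INDEPENDENT OF THE WEIGHT**: `torusPropagator w c k = (c²)⁻¹ • torusPropagator 1 1 k` (`w > 0`, `c ≠ 0`, every `k`) — the covariance of
`exp(−½‖√w·∂^{c}A‖²)` on `δ(Q_kA)δ_{k,Ax}(A)` is `(w·c²)⁻¹` times that of `(1, 1)` (`axialPropagator_smul`) and the pairing
*"⟨A, J⟩ = Σ_b η^dA_bJ_b"* restores the factor `w`. [cite: BalabanImbrieJaffe1985, (4.1.1) p.309] -/
theorem torusPropagator_eq_smul {w c : ℝ} (hw : 0 < w) (hc : c ≠ 0) (k : ℕ) :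
    torusPropagator (P := P) w c k = (c ^ 2)⁻¹ • torusPropagator (P := P) 1 1 k := by
  have hs : Real.sqrt w * c ≠ 0 := mul_ne_zero (Real.sqrt_pos.2 hw).ne' hc
  have hw0 : w ≠ 0 := hw.ne'
  unfold torusPropagator
  rw [curlOp_eq_smul w c, axialPropagator_smul _ _ hs, mul_pow, Real.sq_sqrt hw.le, LinearMap.smul_comp, LinearMap.comp_smul,
    smul_smul, one_smul, mul_inv, ← mul_assoc, mul_inv_cancel₀ hw0, one_mul]

/-- `G_{k,Ax}` of (4.1.1) (weight absorbed) does not depend on the weight `w`. [cite: BalabanImbrieJaffe1985, (4.1.1) p.309] -/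
theorem torusPropagator_indep_w {w w' c : ℝ} (hw : 0 < w) (hw' : 0 < w') (hc : c ≠ 0) (k : ℕ) :
    torusPropagator (P := P) w c k = torusPropagator (P := P) w' c k := by
  rw [torusPropagator_eq_smul hw hc, torusPropagator_eq_smul hw' hc]

/-- at the lattice factor of step `k` (`c = η_k⁻¹ = L^k`): `torusPropagator w L^k k = η_k² • torusPropagator 1 1 k` for every weight
`w > 0` — the (length)² of a gauge-field propagator in lattice units. [cite: BalabanImbrieJaffe1985, (4.1.1) p.309] -/
theorem torusPropagator_eta_eq {w : ℝ} (hw : 0 < w) (k : ℕ) :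
    torusPropagator (P := P) w ((P.L : ℝ) ^ k) k = (P.eta k) ^ 2 • torusPropagator (P := P) 1 1 k := by
  rw [torusPropagator_eq_smul hw (cast_pow_L_pos' k).ne', eta_eq_inv, inv_pow]

/-! ## §4  The gauge functions `λ_k` (I.5.1.13), `D_j` (2.21) and the kernel `C_k` (2.22) -/

/-- the adjoint of a rescaled real operator: `(s•S)* = s•S*`. [folklore] -/
private theorem adjoint_smul' {E F : Type*} [NormedAddCommGroup E] [InnerProductSpace ℝ E] [FiniteDimensional ℝ E]
    [NormedAddCommGroup F] [InnerProductSpace ℝ F] [FiniteDimensional ℝ F] (s : ℝ) (S : E →ₗ[ℝ] F) :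
    LinearMap.adjoint (s • S) = s • LinearMap.adjoint S := by
  rw [map_smulₛₗ, starRingEnd_apply, star_trivial]

/-- **`λ_k` OF (I.5.1.13) IS HOMOGENEOUS OF DEGREE `−1` IN THE LATTICE FACTOR**: `lamOf c k A = c⁻¹ • lamOf 1 k A` — the printed weights
`L^{j−k} = L^jη` are `L^j/c`. [cite: BalabanImbrieJaffe1985, (5.1.13) p.315] -/
theorem lamOf_eq_smul (c : ℝ) : ∀ (k : ℕ) (A : VecField P 0 ℝ), lamOf c k A = c⁻¹ • lamOf 1 k A
  | 0, A => by simp [lamOf]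
  | k + 1, A => by
    rw [lamOf_succ, lamOf_succ, lamOf_eq_smul c k A, smul_sub, smul_smul, div_one, div_eq_mul_inv, mul_comm]

/-- the operator form: `lamE P c k = c⁻¹ • lamE P 1 k`. [cite: BalabanImbrieJaffe1985, (5.1.13) p.315] -/
theorem lamE_eq_smul (c : ℝ) (k : ℕ) : lamE P c k = c⁻¹ • lamE P 1 k := by
  apply LinearMap.ext
  intro v
  rw [LinearMap.smul_apply, lamE_apply, lamE_apply, lamOf_eq_smul, WithLp.toLp_smul]

/-- **`D_j = λ_j ∘ H_j` OF (2.21) IS WEIGHT-FREE AND OF DEGREE `−1` IN `c`**: `DjE P w c j = c⁻¹ • DjE P 1 1 j` (`j ≤ m + K`, `w > 0`,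
`c ≠ 0`). [cite: BalabanImbrieJaffe1988, (2.21) p.262] -/
theorem djE_eq_smul {j : ℕ} (hj : j ≤ P.m + P.K) {w c : ℝ} (hw : 0 < w) (hc : c ≠ 0) : DjE P w c j = c⁻¹ • DjE P 1 1 j := by
  unfold DjE
  rw [hkE_eq_hkE_one hj hw hc, lamE_eq_smul c j, LinearMap.smul_comp]

/-- p30's unit-lattice curl `∂` on `T^{(k)}` (factor `c/L^k`) is linear in the lattice factor: `dOne P k c = c • dOne P k 1`.
[cite: BalabanImbrieJaffe1985, (6.4) p.318] -/
theorem dOne_eq_smul (k : ℕ) (c : ℝ) : dOne P k c = c • dOne P k 1 := by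
  apply LinearMap.ext
  intro B
  ext p
  change dOne P k c B p = c * dOne P k 1 B p
  rw [dOne_apply, dOne_apply, curl, curl, smul_eq_mul, smul_eq_mul, one_div, div_eq_mul_inv, mul_assoc]

/-- **`C_k` OF (2.22) IS WEIGHT-FREE AND OF DEGREE `−1` IN THE LATTICE FACTOR**: `CkE P hd w c k = c⁻¹ • CkE P hd 1 1 k` (`k ≤ m + K`,
`w > 0`, `c ≠ 0`) — in `D_k + Σ_{j<k} D_jC^{(j)}H_j*∂*Q^{e*}_k∂` the constituents scale by `c⁻¹`, `(w·c²)⁻¹`, `1`, `√w·c`, `√w`, `c`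
(§§1–2, §4, p30's `curlOp_eq_smul`/`QesOp_eq_smul`), whose product is `c⁻¹`. [cite: BalabanImbrieJaffe1988, (2.22) p.262] -/
theorem ckE_eq_smul (hd : 2 ≤ P.d) {k : ℕ} (hk : k ≤ P.m + P.K) {w c : ℝ} (hw : 0 < w) (hc : c ≠ 0) :
    CkE P hd w c k = c⁻¹ • CkE P hd 1 1 k := by
  have key : Real.sqrt w * Real.sqrt w = w := Real.mul_self_sqrt hw.le
  have hr0 : Real.sqrt w ≠ 0 := (Real.sqrt_pos.2 hw).ne'
  unfold CkE
  rw [smul_add, Finset.smul_sum, djE_eq_smul hk hw hc]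
  congr 1
  refine Finset.sum_congr rfl fun j hj => ?_
  have hj' : j ≤ P.m + P.K := by have := Finset.mem_range.1 hj; omega
  rw [djE_eq_smul hj' hw hc, cE_eq_smul_cE_one hw hc j, hkE_eq_hkE_one hj' hw hc, curlOp_eq_smul w c, adjoint_smul',
    QesOp_eq_smul hd w k, dOne_eq_smul k c]
  simp only [LinearMap.smul_comp, LinearMap.comp_smul, smul_smul]
  generalize Real.sqrt w = r at key hr0 ⊢
  subst key
  congr 1
  field_simp

end

end Literature.MathematicalPhysics.QuantumFieldTheory.BalabanImbrieJaffe1984to88.BIJ85Prop522Rescaling
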